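import Mathlib.Analysis.SpecialFunctions.Exponential
import Mathlib.RingTheory.MvPolynomial.Basic
import HarnessLib

/-!
# Dasgupta–Kakde 2024, Theorem 7.1 (real case): the support-counting Masser converse for a
# 2 × 2 real logarithm matrix of rank one

One NAMED FACT (D-0014: `def … : Prop`, nothing proved). S. Dasgupta, M. Kakde, *Ranks of
matrices of logarithms of algebraic numbers II: the Matrix Coefficient Conjecture*,
arXiv:2408.08178 (Adv. Math., to appear) [DasguptaKakde2024] — held text `paper:arxiv-2408.08178`,
pp. 7–10 READ for this file.

Printed setting (§4, p. 7; §5, p. 8; §7.1, p. 10).  Rows `x_i = (x_{ij})_{j=1}^{n} ∈ (F^*)^n`,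
`i = 1,…,n`, generate `X ⊂ (F^*)^n`; the pairing `⟨a, b⟩_X = ∏_{i,j} x_{ij}^{a_i b_j}` on
`ℤⁿ × ℤⁿ`; `ℤⁿ(N) = {a : 0 ≤ a_i ≤ N-1}`, `X(N) = {x_1^{a_1} ⋯ x_n^{a_n} : a ∈ ℤⁿ(N)}`
(componentwise products, i.e. the points `(∏_i x_{ij}^{a_i})_j`); `A = (log x_{ij})`;
"(o) There are nonzero elements `a, b ∈ ℤⁿ` such that `⟨a, b⟩_X = 1`";
"(w) The matrix `A` has rank less than `n`";
"(m′) For `N` large enough, there exists a polynomial `P(t_1,…,t_n)` such that `|S(P)| < Nⁿ` and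
`P(x) = 0` for all `x ∈ X(2N)`" (`S(P)` = the support, the set of exponent vectors with nonzero
coefficient).
"**Theorem 7.1.** Suppose that `A ∈ M_2(ℝ)` or `M_2(ℂ_p)` satisfies condition (w). [p-adic
normalisation omitted.] Then (m′) ⟹ (o) for the matrix `A`."  Proof (p. 10): write
`A = (a_i b_j)`, `a, b ∈ ℝ²`; `P = ∑_w c_w t^w` gives `f(z) = ∑_w c_w e^{(w·a)z}` with fewer than
`N²` terms and the `4N²` roots `z = v·b`, `v ∈ ℤ²(2N)`, contradicting Lemma 7.2 (a real
exponential sum with `n` terms has at most `n - 1` zeros — the tree's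
`Literature.Analysis.Approximation.Braess1986_VI_1_1_proper`) "unless two of the `w·a`'s are equal
or two of the `v·b`'s are equal. This gives the desired result that the `a`'s or `b`'s are
linearly dependent over `ℤ`, which is exactly what condition (o) says in this case."
After it (p. 10): "in order to prove the 4 exponentials conjecture over `ℝ` or `ℂ_p`, it suffices
to prove that (w) ⟹ (m′) … Of course, this implication remains a mystery."

Typing choices (read before using the fact).
* REAL CASE ONLY; the rank-`< 2` real matrix is written `A = (a_i b_j)` with `a b : Fin 2 → ℝ`
  (every real `2 × 2` matrix of rank `≤ 1` has this form), and `x_{ij} = Real.exp (a i * b j) > 0`.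
* The polynomial has REAL coefficients (`MvPolynomial (Fin 2) ℝ`): §5 lets `F` be "`ℂ` or `ℂ_p`
  (or any algebraically closed field of characteristic 0)", which does not literally cover
  `A ∈ M_2(ℝ)`, and the printed proof applies the real Lemma 7.2 to the coefficients `c_w`; a
  complex `P` reduces to this case by taking real and imaginary parts, but that sentence is not
  printed, so the weaker (real-coefficient) reading is vendored.  "There exists a polynomial" is
  read as a NONZERO polynomial (for `P = 0` the condition is empty).
* (m′) is transcribed verbatim as "for all `N ≥ N₀` there is such a `P`" (the proof uses one `N`).
* (o) is kept in the multiplicative shape `∏_{i,j} x_{ij}^{a_i b_j} = 1` with `a b : Fin 2 → ℤ`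
  (integer powers `zpow` of the positive reals `x_{ij}`), the shape of the route item below with
  `n = 2`; for these `x_{ij}` it says `e^{(a·a')(b·b')} = 1`, i.e. `a'` or `b'` is `ℤ`-linearly
  dependent.

Why here: grounds crux `SupportMasser` of route `Schanuel/MatrixCoefficients`
(`Summit.Schanuel.Schanuel.Theses.MatrixCoefficients.SupportMasser`, stmt-Schanuel-15347), which
asserts "(m′ for infinitely many `N`) ⟹ (o)" for ALL `n`, over `ℂ`, for ARBITRARY nonzero complex
`x_{ij}` (no logarithm / rank-one structure): the item is far STRONGER than this, the only printed
support-counting case (the all-`n` printed converse, ibid. Theorem 6.1 "(m) ⟹ (o)", uses the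
Bernstein–Kushnirenko degree `BKd(P) < Nⁿ` and the box `X(nN)`, and Masser 1981 Thm 2 the total
degree; mixed volumes are not in Mathlib, so Theorem 6.1 is not typed here).

Deliberately NOT here: the `p`-adic half of Theorem 7.1 (Iwasawa logarithm, `|a_i|_p ≤ p^{-p/(p-1)}`),
Theorem 6.1, Proposition 5.6 "(o) ⟹ (m)", and the conjectures (Conj. 1.2 = the route's crux
`MatrixCoefficient`, an OPEN statement, not a fact).
-/

namespace Literature.NumberTheory.Transcendental

/-- **Dasgupta–Kakde 2024, Theorem 7.1 (real case): (m′) ⟹ (o) for a real `2 × 2` logarithm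
matrix of rank `≤ 1`.**  Let `a, b ∈ ℝ²` and `x_{ij} = e^{a_i b_j}` (so `A = (log x_{ij}) = (a_i b_j)`
has rank `< 2`, condition (w)).  If for all large `N` there is a nonzero real polynomial `P` in two
variables with fewer than `N²` monomials vanishing at every point `(∏_i x_{ij}^{v_i})_{j}`,
`v ∈ [0, 2N)²`, of the box image `X(2N)` (condition (m′)), then there are nonzero `a', b' ∈ ℤ²` with
`∏_{i,j} x_{ij}^{a'_i b'_j} = 1` (condition (o); here: `a'·a = 0` or `b'·b = 0`).  Grounds
`Summit.Schanuel.Schanuel.Theses.MatrixCoefficients.SupportMasser` (its `n = 2`, real, rank-one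
cell; the item itself is stronger, see the module docstring). [cite: DasguptaKakde2024, §7.1 Theorem 7.1 (real case) with Lemma 7.2, pp. 10 of arXiv:2408.08178; conditions (o), (m′) §5 p. 8 and §7.1 p. 10] -/
def DasguptaKakde2024_thm_7_1_real : Prop :=
  ∀ (a b : Fin 2 → ℝ),
    (∃ N₀ : ℕ, ∀ N : ℕ, N₀ ≤ N → ∃ P : MvPolynomial (Fin 2) ℝ, P ≠ 0 ∧ P.support.card < N ^ 2 ∧
        ∀ v : Fin 2 → ℕ, (∀ i, v i < 2 * N) →
          MvPolynomial.eval (fun j => ∏ i, Real.exp (a i * b j) ^ (v i)) P = 0) →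
    ∃ a' b' : Fin 2 → ℤ, a' ≠ 0 ∧ b' ≠ 0 ∧
      ∏ i, ∏ j, Real.exp (a i * b j) ^ (a' i * b' j) = 1

end Literature.NumberTheory.Transcendental
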